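import Mathlib
import Summits.Ventures.PercRepro2.LocRows
import Summits.Ventures.PercRepro2.SwRow
import Summits.Ventures.PercRepro2.SwOut
import Summits.Ventures.PercRepro2.SwAllRow
import Summits.Ventures.PercRepro2.SwOutAll
import Summits.Ventures.PercRepro2.SwOutArmFlip
import Summits.Ventures.PercRepro2.SwOutArms
import Summits.Ventures.PercRepro2.SwOutArmOrbit
import Summits.Ventures.PercRepro2.SwOutArmCube
import Summits.Ventures.PercRepro2.SwOutArmThm
import Summits.Ventures.PercRepro2.SwOutCoreDefs
import Summits.Ventures.PercRepro2.SwOutCoreCube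
import Summits.Ventures.PercRepro2.SwOutShadowDefs
import Summits.Ventures.PercRepro2.SwOutShadowCube
import Summits.Ventures.PercRepro2.SwOutCoreShadowDefs
import Summits.Ventures.PercRepro2.SwOutCoreShadowKey
import Summits.Ventures.PercRepro2.SwOutCoreShadowKind
import Summits.Ventures.PercRepro2.SwOutJunctionH1Defs
import Summits.Ventures.PercRepro2.SwOutJunctionH1Kinds
import Summits.Ventures.PercRepro2.SwOutJunctionH1Key
import Summits.Ventures.PercRepro2.SwOutJunctionH1EdgeDefs

/-!
# The edge `h–u` by subdivision: every block of a uniform point is uniform (blind cell PercRepro2,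
night-4 g29, 2026-08-28; proofs/NIGHT4-G29.md §2)

In the subdivided graph `G⁺` a configuration is UNIFORM when `h–w` and `w–u` have the same colour
(`Uniform`).  Every move of g14's block decomposition of a class of `G⁺` — the arm flips of the
coarse orbits, the cube flips of the core cubes, the recolouring of the `u`–`sZ` edges and the flips
of the shadow cubes — is the flip of a vertex set `S` with `h ∉ S` and `u ∈ S → w ∈ S` (the arm of
`w` is the u-adjacent h-arm `{w}`, red at every one-sided point), and the bases are uniform by the
`CoreBase` fields; so uniformity is preserved along every block (`uniform_orbitReal`,
`uniform_coreReal`, `uniform_shadowReal`), and **every block of a uniform `Q`-point of a class of `G⁺`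
consists of uniform points** (`uniform_of_mem_blockOf`).
-/

namespace Summit.Ventures.PercRepro2

namespace LocRows

open Hull

variable {V : Type*} {E : Type*} [Fintype E] [DecidableEq E]

open scoped Classical

/-- A configuration of `G⁺` is uniform when `h–w` and `w–u` have the same colour. -/
def Uniform (e₀ : E) (ζ : Config (E ⊕ Bool)) : Prop := ζ (Sum.inl e₀) = ζ (Sum.inr false)

section Basic

variable {ends : E → Sym2 V} {e₀ : E} {h u l : V}

omit [Fintype E] [DecidableEq E] in
/-- The uniform lift is uniform. -/
lemma uniform_ulift (ζ : Config E) : Uniform e₀ (ulift e₀ ζ) := rfl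

omit [Fintype E] [DecidableEq E] in
/-- The colour swap preserves uniformity. -/
lemma uniform_blue {ζ : Config (E ⊕ Bool)} (hζ : Uniform e₀ ζ) : Uniform e₀ (blue ζ) := by
  unfold Uniform at hζ ⊢
  simp only [blue_apply, hζ]

omit [Fintype E] in
/-- The edge `h–w` touches `S` iff `h` or `w` is in `S`. -/
lemma inl_e₀_mem_touches_iff {S : Set (Option V)} :
    Sum.inl e₀ ∈ touches (subdEnds ends e₀ h u l) S ↔ some h ∈ S ∨ none ∈ S :=
  mem_touches_iff_of_ends subdEnds_inl_self

omit [Fintype E] in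
/-- The edge `w–u` touches `S` iff `w` or `u` is in `S`. -/
lemma inr_false_mem_touches_iff {S : Set (Option V)} :
    Sum.inr false ∈ touches (subdEnds ends e₀ h u l) S ↔ none ∈ S ∨ some u ∈ S :=
  mem_touches_iff_of_ends subdEnds_inr_false

omit [Fintype E] in
/-- **The flip of a set `S` with `h ∉ S` and `u ∈ S → w ∈ S` preserves uniformity**: the edges `h–w`
and `w–u` flip together (both iff `w ∈ S`). -/
theorem uniform_flip {S : Set (Option V)} (hh : some h ∉ S) (huw : some u ∈ S → none ∈ S)
    {ζ : Config (E ⊕ Bool)} (hζ : Uniform e₀ ζ) :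
    Uniform e₀ (flip (subdEnds ends e₀ h u l) S ζ) := by
  unfold Uniform at hζ ⊢
  by_cases hw : (none : Option V) ∈ S
  · rw [flip_apply_of_mem (inl_e₀_mem_touches_iff.2 (Or.inr hw)),
      flip_apply_of_mem (inr_false_mem_touches_iff.2 (Or.inl hw)), hζ]
  · rw [flip_apply_of_notMem, flip_apply_of_notMem, hζ]
    · rw [inr_false_mem_touches_iff]
      rintro (h1 | h1)
      · exact hw h1
      · exact hw (huw h1)
    · rw [inl_e₀_mem_touches_iff]
      rintro (h1 | h1)
      · exact hh h1
      · exact hw h1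

omit [Fintype E] in
/-- `w` lies in the hull of `h` of every uniform configuration. -/
lemma none_mem_hull_of_uniform {ζ : Config (E ⊕ Bool)} (_hζ : Uniform e₀ ζ) :
    (none : Option V) ∈ hull (subdEnds ends e₀ h u l) ζ (some h) := by
  cases hc : ζ (Sum.inl e₀)
  · right
    exact mem_cluster_of_edge (e := Sum.inl e₀) (mem_cluster_self _ _ _)
      (by rw [blue_eq_true_iff]; exact hc) (by simp)
  · left
    exact mem_cluster_of_edge (e := Sum.inl e₀) (mem_cluster_self _ _ _) hc (by simp)

omit [Fintype E] in
/-- `u` lies in the hull of `h` of every uniform configuration (through `w`). -/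
lemma some_u_mem_hull_of_uniform {ζ : Config (E ⊕ Bool)} (hζ : Uniform e₀ ζ) :
    some u ∈ hull (subdEnds ends e₀ h u l) ζ (some h) := by
  cases hc : ζ (Sum.inl e₀)
  · right
    have hw : (none : Option V) ∈ cluster (subdEnds ends e₀ h u l) (blue ζ) (some h) :=
      mem_cluster_of_edge (e := Sum.inl e₀) (mem_cluster_self _ _ _)
        (by rw [blue_eq_true_iff]; exact hc) (by simp)
    exact mem_cluster_of_edge (e := Sum.inr false) hw
      (by rw [blue_eq_true_iff]; exact hζ.symm.trans hc) (by simp)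
  · left
    have hw : (none : Option V) ∈ cluster (subdEnds ends e₀ h u l) ζ (some h) :=
      mem_cluster_of_edge (e := Sum.inl e₀) (mem_cluster_self _ _ _) hc (by simp)
    exact mem_cluster_of_edge (e := Sum.inr false) hw (hζ.symm.trans hc) (by simp)

omit [Fintype E] in
/-- **The all-red orientation of a uniform core-free configuration is uniform**: the flipped set is
the blue cluster minus `h`, and `u` in it forces `w` in it (else `u` would be a core). -/
theorem uniform_allRed (hhu : h ≠ u) {ζ : Config (E ⊕ Bool)} (hζ : Uniform e₀ ζ)
    (hc : CoreFree (subdEnds ends e₀ h u l) ζ (some h)) :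
    Uniform e₀ (allRed (subdEnds ends e₀ h u l) ζ (some h)) := by
  unfold allRed
  refine uniform_flip (by simp) ?_ hζ
  rintro ⟨huT', -⟩
  refine ⟨?_, by simp⟩
  cases hcol : ζ (Sum.inr false)
  · exact mem_cluster_of_edge (e := Sum.inr false) huT' (by rw [blue_eq_true_iff]; exact hcol)
      (by rw [subdEnds_inr_false, Sym2.eq_swap])
  · exfalso
    have hhw : ζ (Sum.inl e₀) = true := hζ.trans hcol
    have hwT : (none : Option V) ∈ cluster (subdEnds ends e₀ h u l) ζ (some h) :=
      mem_cluster_of_edge (e := Sum.inl e₀) (mem_cluster_self _ _ _) hhw (by simp)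
    have huT : some u ∈ cluster (subdEnds ends e₀ h u l) ζ (some h) :=
      mem_cluster_of_edge (e := Sum.inr false) hwT hcol (by simp)
    exact hhu (Option.some_injective _ (hc (some u) huT huT')).symm

/-- **Every point of the coarse orbit of a uniform core-free configuration is uniform**: the arms
flipped are unions of components of `G⁺[H ∖ {h}]`, and `u` and `w` share their component. -/
theorem uniform_orbitReal (hhu : h ≠ u) {ρ : Config (E ⊕ Bool)} (hρ : Uniform e₀ ρ)
    (hc : CoreFree (subdEnds ends e₀ h u l) ρ (some h))
    (ω : Config (arms (subdEnds ends e₀ h u l) ρ (some h))) :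
    Uniform e₀ (orbitReal (subdEnds ends e₀ h u l) ρ (some h) ω) := by
  unfold orbitReal
  refine uniform_flip ?_ ?_ (uniform_allRed hhu hρ hc)
  · intro hh
    exact (mem_hull_sdiff_of_mem_armsFalse hh).2 rfl
  · intro hu
    have huH : some u ∈ hull (subdEnds ends e₀ h u l) ρ (some h) :=
      (mem_hull_sdiff_of_mem_armsFalse hu).1
    obtain ⟨P, hP, huP⟩ := hu
    refine ⟨P, hP, ?_⟩
    obtain ⟨e, he, hPe⟩ := Finset.mem_image.1 P.2
    rw [← hPe] at huP ⊢
    obtain ⟨y, hy, hyh, huy⟩ := huP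
    refine ⟨y, hy, hyh, ?_⟩
    refine mem_cluster_of_edge (e := Sum.inr false) huy ?_ (by rw [subdEnds_inr_false, Sym2.eq_swap])
    rw [armConfig_eq_true_iff]
    refine ⟨none, ⟨none_mem_hull_of_uniform hρ, by simp⟩, some u, ⟨huH, ?_⟩, by simp⟩
    simp only [Set.mem_singleton_iff, Option.some.injEq]
    exact fun h' => hhu h'.symm

end Basic

/-! ## The core cubes and the shadow blocks -/

section Blocks

variable {ends : E → Sym2 V} {e₀ : E} {h u l : V}

omit [Fintype E] in
/-- A core base of `G⁺` with junction `u` is uniform: its `h`-edges and `u`-edges are red. -/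
lemma uniform_of_coreBase {ι : Type*} {A : ι → Set (Option V)} {pure : ι → Prop}
    {b : Config (E ⊕ Bool)} {H : Set (Option V)}
    (hb : CoreBase (subdEnds ends e₀ h u l) b (some h) (some u) H A pure) : Uniform e₀ b := by
  unfold Uniform
  rw [hb.h_red (Sum.inl e₀) none (by simp),
    hb.u_red (Sum.inr false) none (by rw [subdEnds_inr_false, Sym2.eq_swap])]

omit [Fintype E] in
/-- **Every point of a core cube of `G⁺` is uniform**: the arms avoid `h` and `u`. -/
theorem uniform_coreReal {ι : Type*} {A : ι → Set (Option V)} {pure : ι → Prop}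
    {b : Config (E ⊕ Bool)} {H : Set (Option V)}
    (hb : CoreBase (subdEnds ends e₀ h u l) b (some h) (some u) H A pure) (ω : Config ι) :
    Uniform e₀ (coreReal (subdEnds ends e₀ h u l) A b ω) := by
  unfold coreReal
  refine uniform_flip ?_ ?_ (uniform_of_coreBase hb)
  · rintro ⟨i, _, hi⟩
    exact (hb.arm_sub i _ hi).2.1 rfl
  · rintro ⟨i, _, hi⟩
    exact absurd rfl (hb.arm_sub i _ hi).2.2

omit [Fintype E] in
/-- The arm of `w` in a core base of `G⁺` is not pure (it carries the edge `h–w`). -/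
lemma not_pureC_of_none_mem {P : Set (Option V)} (hw : (none : Option V) ∈ P) :
    ¬ pureC (subdEnds ends e₀ h u l) (some h) P :=
  fun hp => hp (Sum.inl e₀) none (by simp) hw

omit [Fintype E] in
/-- The arm of `w` is adjacent to `u` (the edge `w–u`). -/
lemma uAdjC_of_none_mem {ι : Type*} {A : ι → Set (Option V)} {i : ι} (hw : (none : Option V) ∈ A i) :
    uAdjC (subdEnds ends e₀ h u l) (some u) A i :=
  ⟨Sum.inr false, none, by rw [subdEnds_inr_false, Sym2.eq_swap], hw⟩

/-- At the one-sided point of shadow data, the arm of `w` is red: a blue u-adjacent h-arm would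
make `u` red at the flipped point. -/
lemma omegaSR_eq_true_of_none_mem {U' : Set (Option V)} {ξ' : Config (E ⊕ Bool)}
    {b : Config (E ⊕ Bool)} {S R : Finset (Set (Option V))}
    (hd : ShadowData (subdEnds ends e₀ h u l) U' ξ' (some h) (some u) b S R) {P : S}
    (hw : (none : Option V) ∈ P.1) : omegaSR S R P = true := by
  by_contra hP
  simp only [Bool.not_eq_true] at hP
  apply hd.huB
  refine ⟨P, by simp [flipAll, hP], not_pureC_of_none_mem hw, Sum.inr false, none,
    by rw [subdEnds_inr_false, Sym2.eq_swap], hw⟩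

/-- `w` is not a dropped vertex of shadow data. -/
lemma none_notMem_sZ {U' : Set (Option V)} {ξ' : Config (E ⊕ Bool)} {b : Config (E ⊕ Bool)}
    {S R : Finset (Set (Option V))}
    (hd : ShadowData (subdEnds ends e₀ h u l) U' ξ' (some h) (some u) b S R) :
    (none : Option V) ∉ sZ (subdEnds ends e₀ h u l) (some u) (armsFun S) (omegaSR S R) := by
  rintro ⟨P, _, hP, hw⟩
  have := omegaSR_eq_true_of_none_mem hd hw
  rw [hP] at this
  exact absurd this (by decide)

/-- `w` lies in the coarse arm `sX` of shadow data. -/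
lemma none_mem_sX {U' : Set (Option V)} {ξ' : Config (E ⊕ Bool)} {b : Config (E ⊕ Bool)}
    {S R : Finset (Set (Option V))}
    (hd : ShadowData (subdEnds ends e₀ h u l) U' ξ' (some h) (some u) b S R) :
    (none : Option V) ∈ sX (subdEnds ends e₀ h u l) (some u) (armsFun S) (omegaSR S R) := by
  have hwH : (none : Option V) ∈ extHull (subdEnds ends e₀ h u l) b (some h) (some u) :=
    Or.inl (none_mem_hull_of_uniform (uniform_of_coreBase hd.hb))
  obtain ⟨P, hP⟩ := hd.hb.arm_cover none hwH (by simp) (by simp)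
  rw [mem_sX_iff]
  exact Or.inr ⟨P, uAdjC_of_none_mem hP, omegaSR_eq_true_of_none_mem hd hP, hP⟩

/-- The shadow base of shadow data of `G⁺` is uniform: the recoloured edges join `u` to the dropped
arms, and `w` is not dropped. -/
lemma uniform_shadowOf {U' : Set (Option V)} {ξ' : Config (E ⊕ Bool)} {b : Config (E ⊕ Bool)}
    {S R : Finset (Set (Option V))}
    (hd : ShadowData (subdEnds ends e₀ h u l) U' ξ' (some h) (some u) b S R) :
    Uniform e₀ (shadowOf (subdEnds ends e₀ h u l) (some u) (armsFun S) (omegaSR S R) b) := by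
  have hb := uniform_of_coreBase hd.hb
  unfold Uniform at hb ⊢
  rw [shadowOf_apply_of_not, shadowOf_apply_of_not, hb]
  · rintro ⟨z, hz, hez⟩
    rw [subdEnds_inr_false, Sym2.eq_iff] at hez
    rcases hez with ⟨h1, _⟩ | ⟨h1, _⟩
    · exact absurd h1 (by simp)
    · exact none_notMem_sZ hd (h1 ▸ hz)
  · rintro ⟨z, _, hez⟩
    rw [subdEnds_inl_self, Sym2.eq_iff] at hez
    rcases hez with ⟨h1, _⟩ | ⟨_, h2⟩
    · exact absurd (Option.some_injective _ h1) (by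
        rintro rfl
        exact hd.hb.hne rfl)
    · exact absurd h2 (by simp)

/-- **Every point of the shadow block of shadow data of `G⁺` is uniform**: the flipped sets are
the coarse arm `sX` (which contains `w` with `u`), far arms and dropped arms (which avoid both). -/
theorem uniform_shadowReal {U' : Set (Option V)} {ξ' : Config (E ⊕ Bool)} {b : Config (E ⊕ Bool)}
    {S R : Finset (Set (Option V))}
    (hd : ShadowData (subdEnds ends e₀ h u l) U' ξ' (some h) (some u) b S R)
    (ω' : Config (Option {i : S // ¬ uAdjC (subdEnds ends e₀ h u l) (some u) (armsFun S) i})) :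
    Uniform e₀ (shadowReal (subdEnds ends e₀ h u l)
      (sB (subdEnds ends e₀ h u l) (some u) (armsFun S) (omegaSR S R))
      (sZ (subdEnds ends e₀ h u l) (some u) (armsFun S) (omegaSR S R)) none
      (shadowOf (subdEnds ends e₀ h u l) (some u) (armsFun S) (omegaSR S R) b) ω') := by
  unfold shadowReal
  refine uniform_flip ?_ ?_ (uniform_shadowOf hd)
  · rintro (⟨j, _, hj⟩ | ⟨_, hZ⟩)
    · rcases j with _ | i
      · rcases (mem_sX_iff).1 hj with h1 | ⟨P, _, _, hP⟩
        · exact hd.hb.hne h1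
        · exact (hd.hb.arm_sub P _ hP).2.1 rfl
      · exact (hd.hb.arm_sub i.1 _ hj).2.1 rfl
    · obtain ⟨P, _, _, hP⟩ := (mem_sZ_iff).1 hZ
      exact (hd.hb.arm_sub P _ hP).2.1 rfl
  · rintro (⟨j, hωj, hj⟩ | ⟨_, hZ⟩)
    · rcases j with _ | i
      · exact Or.inl ⟨none, hωj, none_mem_sX hd⟩
      · exact absurd rfl (hd.hb.arm_sub i.1 _ hj).2.2
    · obtain ⟨P, _, _, hP⟩ := (mem_sZ_iff).1 hZ
      exact absurd rfl (hd.hb.arm_sub P _ hP).2.2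

end Blocks

/-! ## The blocks of a uniform point -/

section Main

variable {ends : E → Sym2 V} {e₀ : E} {h u l o : V} {U' : Set (Option V)} {ξ' : Config (E ⊕ Bool)}

variable (hl : some l ∉ U') (hhu : h ≠ u)
  (hloop_h : ∀ e, subdEnds ends e₀ h u l e ≠ s(some h, some h))
  (hloop_u : ∀ e, subdEnds ends e₀ h u l e ≠ s(some u, some u))
  (hnadj : ∀ e, subdEnds ends e₀ h u l e ≠ s(some h, some u))
  (hout : ∀ x ∈ U', x ≠ some h → x ≠ some o → x ≠ some u →
    (∃ e y, subdEnds ends e₀ h u l e = s(x, y) ∧ y ∉ U') ∨ (∀ e, x ∉ subdEnds ends e₀ h u l e))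
  (hH1 : H1 (subdEnds ends e₀ h u l) U' (some h) (some u))
include hl hhu hloop_h hloop_u hnadj hout hH1

/-- **Every block of a uniform `Q`-point of a class of `G⁺` consists of uniform points.** -/
theorem uniform_of_mem_blockOf {ζ : Config (E ⊕ Bool)}
    (hζ : ζ ∈ swOutSide (subdEnds ends e₀ h u l) (some l) (some h) (some o) U' ξ')
    (hun : Uniform e₀ ζ) {ζ' : Config (E ⊕ Bool)}
    (hζ' : ζ' ∈ blockOf (subdEnds ends e₀ h u l) (some h) (some u)
      (keyOf (subdEnds ends e₀ h u l) U' ξ' (some h) (some u) ζ)) : Uniform e₀ ζ' := by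
  have hhu' : (some h : Option V) ≠ some u := fun h' => hhu (Option.some_injective _ h')
  have hu : some u ∈ hull (subdEnds ends e₀ h u l) ζ (some h) := some_u_mem_hull_of_uniform hun
  by_cases hk : hull (subdEnds ends e₀ h u l) ζ (some u) ⊆ U'
  · rw [keyOf_of_coreKind hu hk] at hζ'
    have hb := coreBase_of_coreKind hl hhu' hloop_h hloop_u hnadj hout hH1 hζ ⟨hu, hk⟩
    obtain ⟨ω, rfl⟩ := (mem_coreCube).1 hζ'
    exact uniform_coreReal hb ω
  by_cases hs : ShadowKind (subdEnds ends e₀ h u l) U' ξ' (some h) (some u) ζ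
  · rw [keyOf_of_shadowKind hu hk hs] at hζ'
    simp only [blockOf, shadowBlock] at hζ'
    obtain ⟨ω', rfl⟩ := (mem_shadowCube).1 hζ'
    exact uniform_shadowReal hs.1 ω'
  · rw [keyOf_of_plain hu hk hs] at hζ'
    have hc : CoreFree (subdEnds ends e₀ h u l) ζ (some h) := coreFree_of_escaping hout hζ hk
    simp only [blockOf, orbit, Finset.mem_image, Finset.mem_univ, true_and] at hζ'
    obtain ⟨ω, rfl⟩ := hζ'
    exact uniform_orbitReal hhu (uniform_allRed hhu hun hc) (coreFree_allRed hc) ω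

end Main

end LocRows

end Summit.Ventures.PercRepro2
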